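import Summits.HubbardSuperconductivity.HubbardSuperconductivity.Theorems.MesoscopicPairOrder.Negative.PolarisedLadder
import Summits.HubbardSuperconductivity.HubbardSuperconductivity.Theorems.ThermalWedgeTwSourcedInertnessReduction
import HarnessLib

/-!
# Crux `MesoscopicPairOrder` (item `stmt-HubbardSuperconductivity-7331`): the POLARISED ceiling, II —
# Fejér block pair order is bounded by `R²` times the spin deficiency

Negative-side support (lead c8, line `pointwise_split`), file 2 of 2 (file 1: `PolarisedLadder.lean`, the
`su(2)` ladder transfer `su2_re_form_P_pow_eq` and the locality bound `sum_re_localPair_le_down`). The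
disprover's exclusion (`Negative/SaturatedExclusion.pointwise_false_of_saturated`) rests on `P_x ψ = 0` for a
SATURATED ferromagnet; its workfile (§4 (iii)) records that the quantitative version via the all-pairs
singlet sum rule is vacuous already at spin deficiency `1` and asks for a LOCAL version. Here it is:

* `boxSum_le_sq_mul_spinDeficiency` — for a vector `ψ` of the `S^z = 0` sector `(n, n)` of the `L × L`
  torus with `S² ψ = S(S+1) ψ` (`S ≤ n`) and `0 < R`, `2R ≤ L`:
  `T_R(ψ) ≤ 4 κ_d |E| · R² · (n - S) · ‖ψ‖²`. Proof: the top member `φ = (S⁺)^S ψ ∈ (n + S, n - S)` has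
  `T_R(φ)/‖φ‖² = T_R(ψ)/‖ψ‖²` (ladder transfer with `K = K_R`, which commutes with `S⁻`,
  `boxRepulsion_commute_spinMinus`); `T_R(φ) ≤ R² Σ_x ‖P_x φ‖²` (`boxSum_le_sq_mul_localWeight`)
  `≤ R² · 4 κ_d |E| (n - S) ‖φ‖²` (locality, `n - S` down electrons).
* `polarisedConstant_le_hundred`, `boxSum_le_hundred_mul_spinDeficiency` — the constant is `≤ 100`:
  **`T_R(ψ) ≤ 100 · R² · (n - S) · ‖ψ‖²`**.

At `S = n` this is the saturated case `T_R = 0`; for spin deficiency `n - S = o(L²)` it still forces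
`T_R(ψ)/L² → 0` at every fixed scale, so the crux margin `m` at `(U, δ)` forces `n - S ≥ m L²/100` in EVERY
`S²`-diagonal sector ground state of every large even torus — an EXTENSIVE spin deficiency (polarisation
bounded away from saturation); the exclusion / necessity corollaries for the crux body and for stub (B) are
in `PolarisedExclusion.lean`. Sources: H. Tasaki, Prog. Theor. Phys. 99 (1998) 489, p. 20; H. Tasaki,
*Physics and Mathematics of Quantum Many-Body Systems* (2020) §2.4; E. H. Lieb, PRL 62 (1989) 1201;
D. J. Scalapino, Phys. Rep. 250 (1995) 329, §2. No definition, no named fact, no sorry.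
-/

noncomputable section

-- the summit namespace repeats the problem name by design (D-0017)
set_option linter.dupNamespace false

namespace Summit.HubbardSuperconductivity.HubbardSuperconductivity.Theorems.MesoscopicPairOrder.Negative

open Matrix Finset Filter
open Literature.Probability.LatticeModels Literature.MathematicalPhysics.QuantumLattice
open scoped ComplexOrder ComplexConjugate

section Polarised

variable {L : ℕ} [NeZero L]

omit [NeZero L] in
/-- Raising inside Lieb's sectors: `(S⁺)ʲ` maps the `S^z = 0` sector `(n, n)` into `(n + j, n - j)` for
`j ≤ n` (`LiebThm1.raisesSpin_spinPlus`). Lieb, PRL 62 (1989) 1201, eq. (2). [folklore] -/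
theorem isInSector_spinPlus_pow_mulVec {n : ℕ} {w : Fock (Orb (FermionTorus 2 L))} (hw : IsInSector n n w) :
    ∀ j : ℕ, j ≤ n → IsInSector (n + j) (n - j) (spinPlus ^ j *ᵥ w) := by
  intro j
  induction j with
  | zero => intro _; simpa using hw
  | succ j ih =>
    intro hj
    have hs := ih (by omega)
    rw [show n - j = (n - (j + 1)) + 1 by omega] at hs
    rw [pow_succ', ← mulVec_mulVec, show n + (j + 1) = (n + j) + 1 by omega]
    exact LiebThm1.raisesSpin_spinPlus.isInSector_mulVec hs

/-- The box pair operator `K_R = Σ_{x,y} W_R(y - x) • (P_xᴴ P_y)` commutes with `S⁻` (each `P_x` and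
`P_xᴴ` does, `PairChirality.spin_commute_localPair`). [folklore] -/
theorem boxRepulsion_commute_spinMinus (R : ℕ) :
    Commute (∑ x : TorusSite 2 L, ∑ y : TorusSite 2 L,
        ((∏ i : Fin 2, max 0 (1 - |(((y i - x i).valMinAbs : ℤ) : ℝ)| / (R : ℝ)) : ℝ) : ℂ) •
          ((localPair dWaveFormFactor L x)ᴴ * localPair dWaveFormFactor L y))
      (spinMinus : Matrix (Finset (Orb (FermionTorus 2 L))) (Finset (Orb (FermionTorus 2 L))) ℂ) := by
  refine (Commute.sum_right _ _ _ fun x _ => Commute.sum_right _ _ _ fun y _ => ?_).symm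
  refine Commute.smul_right ?_ _
  exact ((PairChirality.spin_commute_localPair L dWaveFormFactor x).2.2.2).mul_right
    (PairChirality.spin_commute_localPair L dWaveFormFactor y).2.1

/-- **THE POLARISED CEILING.** Let `ψ` be a vector of the `S^z = 0` sector `(n, n)` of the `L × L` torus
with total spin `S`, `S² ψ = S(S+1) ψ` (`S ≤ n`), and `0 < R`, `2R ≤ L`. Then its Fejér block pair order is
bounded by `R²` times its SPIN DEFICIENCY `n - S`:
`T_R(ψ) ≤ 4 κ_d |E| · R² · (n - S) · ‖ψ‖²` (`κ_d = Σ_{e ∈ E} |g_d(e)/√2|²`, `E = {0} ∪ unitSteps`).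
Proof: the top member `φ = (S⁺)^S ψ` of `ψ`'s multiplet lies in `(n + S, n - S)` and has
`T_R(φ)/‖φ‖² = T_R(ψ)/‖ψ‖²` (`IsSu2Triple.re_form_P_pow_eq` with `K = K_R`, which commutes with `S⁻`);
`T_R(φ) ≤ R² Σ_x ‖P_x φ‖²` (`boxSum_le_sq_mul_localWeight`) `≤ R² · 4 κ_d |E| (n - S) ‖φ‖²`
(`sum_re_localPair_le_down`). At `S = n` this is the saturated case `T_R = 0`
(`SaturatedExclusion.boxSum_eq_zero_of_saturated`); for `n - S = o(L²)` it still forces `T_R/L² → 0`.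
Tasaki, Prog. Theor. Phys. 99 (1998) 489, p. 20; Tasaki (2020) §2.4. [folklore] -/
theorem boxSum_le_sq_mul_spinDeficiency (R : ℕ) (hR : 0 < R) (hRL : 2 * R ≤ L) {n S : ℕ} (hS : S ≤ n)
    {ψ : Fock (Orb (FermionTorus 2 L))} (hψ : IsInSector n n ψ)
    (hspin : spinSq *ᵥ ψ = (((S : ℝ) * ((S : ℝ) + 1) : ℝ) : ℂ) • ψ) :
    (∑ x : TorusSite 2 L, ∑ y : TorusSite 2 L,
        (∏ i : Fin 2, max 0 (1 - |(((y i - x i).valMinAbs : ℤ) : ℝ)| / (R : ℝ))) *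
          (star (localPair dWaveFormFactor L x *ᵥ ψ) ⬝ᵥ (localPair dWaveFormFactor L y *ᵥ ψ)).re) ≤
      4 * (∑ e ∈ insert 0 unitSteps, ‖((dWaveFormFactor e / Real.sqrt 2 : ℝ) : ℂ)‖ ^ 2) *
        ((insert (0 : Site 2) unitSteps).card : ℝ) * (R : ℝ) ^ 2 * ((n - S : ℕ) : ℝ) *
          (star ψ ⬝ᵥ ψ).re := by
  classical
  set K : Matrix (Finset (Orb (FermionTorus 2 L))) (Finset (Orb (FermionTorus 2 L))) ℂ :=
    ∑ x : TorusSite 2 L, ∑ y : TorusSite 2 L,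
      ((∏ i : Fin 2, max 0 (1 - |(((y i - x i).valMinAbs : ℤ) : ℝ)| / (R : ℝ)) : ℝ) : ℂ) •
        ((localPair dWaveFormFactor L x)ᴴ * localPair dWaveFormFactor L y) with hK_def
  set κ : ℝ := 4 * (∑ e ∈ insert 0 unitSteps, ‖((dWaveFormFactor e / Real.sqrt 2 : ℝ) : ℂ)‖ ^ 2) *
    ((insert (0 : Site 2) unitSteps).card : ℝ) with hκ_def
  have hκ0 : 0 ≤ κ := by
    have : 0 ≤ ∑ e ∈ insert 0 unitSteps, ‖((dWaveFormFactor e / Real.sqrt 2 : ℝ) : ℂ)‖ ^ 2 :=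
      Finset.sum_nonneg fun _ _ => by positivity
    rw [hκ_def]; positivity
  -- the `su(2)` data
  have htri := LiebTwo.isSu2Triple_spin (Λ := FermionTorus 2 L)
  have hZ0 : HubbardWave0.spinZ *ᵥ ψ = 0 := by
    rw [LiebThm1.spinZ_mulVec_of_isInSector hψ, sub_self, mul_zero, zero_smul]
  have hC : su2Casimir spinPlus spinMinus HubbardWave0.spinZ *ᵥ ψ = ((S : ℂ) * (S + 1)) • ψ := by
    rw [LiebTwo.su2Casimir_spin_eq_spinSq, hspin]
    push_cast
    rfl
  -- the top member
  set φ : Fock (Orb (FermionTorus 2 L)) := spinPlus ^ S *ᵥ ψ with hφ_def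
  have hφsec : IsInSector (n + S) (n - S) φ := isInSector_spinPlus_pow_mulVec hψ S hS
  set c : ℝ := ((∏ i ∈ Finset.range S, ((S - i) * (S + i + 1)) : ℕ) : ℝ) with hc_def
  have hc : 0 < c := by rw [hc_def]; exact_mod_cast ladderProd_pos S
  have hKφ : (star φ ⬝ᵥ (K *ᵥ φ)).re = c * (star ψ ⬝ᵥ (K *ᵥ ψ)).re :=
    su2_re_form_P_pow_eq htri K (boxRepulsion_commute_spinMinus R) hZ0 S hC
  have hnφ : (star φ ⬝ᵥ φ).re = c * (star ψ ⬝ᵥ ψ).re := su2_re_normSq_P_pow_eq htri hZ0 S hC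
  -- `T_R` as the expectation of `K`
  have hTψ := Theorems.FunctionFieldCertificate.stub_boxExpectation L R ψ
  have hTφ := Theorems.FunctionFieldCertificate.stub_boxExpectation L R φ
  -- ceiling and locality at the top member
  have hceil := boxSum_le_sq_mul_localWeight L R hR hRL φ
  have hloc := sum_re_localPair_le_down (L := L) dWaveFormFactor hφsec
  have hR2 : (0 : ℝ) ≤ (R : ℝ) ^ 2 := by positivity
  -- `c · T_R(ψ) = T_R(φ) ≤ R² · κ (n - S) · c ‖ψ‖²`
  have hmain : c * (star ψ ⬝ᵥ (K *ᵥ ψ)).re ≤ c * (κ * (R : ℝ) ^ 2 * ((n - S : ℕ) : ℝ) * (star ψ ⬝ᵥ ψ).re) := by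
    rw [← hKφ, hTφ]
    calc _ ≤ (R : ℝ) ^ 2 * ∑ x : TorusSite 2 L,
          (star (localPair dWaveFormFactor L x *ᵥ φ) ⬝ᵥ (localPair dWaveFormFactor L x *ᵥ φ)).re := hceil
      _ ≤ (R : ℝ) ^ 2 * (κ * ((n - S : ℕ) : ℝ) * (star φ ⬝ᵥ φ).re) := by
          refine mul_le_mul_of_nonneg_left ?_ hR2
          rw [hκ_def]
          exact hloc
      _ = c * (κ * (R : ℝ) ^ 2 * ((n - S : ℕ) : ℝ) * (star ψ ⬝ᵥ ψ).re) := by rw [hnφ]; ring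
  have hfin := le_of_mul_le_mul_left hmain hc
  rw [hTψ] at hfin
  calc _ ≤ κ * (R : ℝ) ^ 2 * ((n - S : ℕ) : ℝ) * (star ψ ⬝ᵥ ψ).re := hfin
    _ = _ := by rw [hκ_def]

/-- The constant of the polarised ceiling for the `d`-wave pair is at most `100`
(`|g_d| ≤ 1`, the tree's `Theorems.abs_dWaveFormFactor_le_one`; `√2 ≥ 1`; five steps `{0} ∪ unitSteps`,
`PairFieldCarrier.card_insert_zero_unitSteps`). [folklore] -/
theorem polarisedConstant_le_hundred :
    4 * (∑ e ∈ insert 0 unitSteps, ‖((dWaveFormFactor e / Real.sqrt 2 : ℝ) : ℂ)‖ ^ 2) *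
        ((insert (0 : Site 2) unitSteps).card : ℝ) ≤ 100 := by
  have hterm : ∀ e : Site 2, ‖((dWaveFormFactor e / Real.sqrt 2 : ℝ) : ℂ)‖ ^ 2 ≤ 1 := by
    intro e
    rw [Complex.norm_real, Real.norm_eq_abs, abs_div, abs_of_pos (Real.sqrt_pos.2 two_pos)]
    have h1 : |dWaveFormFactor e| ≤ 1 := Theorems.abs_dWaveFormFactor_le_one e
    have h2 : (1 : ℝ) ≤ Real.sqrt 2 := Real.one_le_sqrt.2 (by norm_num)
    have h3 : |dWaveFormFactor e| / Real.sqrt 2 ≤ 1 := by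
      rw [div_le_one (by positivity)]
      exact h1.trans h2
    have h0 : 0 ≤ |dWaveFormFactor e| / Real.sqrt 2 := by positivity
    nlinarith
  have hsum : (∑ e ∈ insert 0 unitSteps, ‖((dWaveFormFactor e / Real.sqrt 2 : ℝ) : ℂ)‖ ^ 2) ≤ 5 := by
    calc (∑ e ∈ insert 0 unitSteps, ‖((dWaveFormFactor e / Real.sqrt 2 : ℝ) : ℂ)‖ ^ 2)
        ≤ ∑ e ∈ insert (0 : Site 2) unitSteps, (1 : ℝ) := Finset.sum_le_sum fun e _ => hterm e
      _ = 5 := by rw [Finset.sum_const, PairFieldCarrier.card_insert_zero_unitSteps]; norm_num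
  have hnn : 0 ≤ ∑ e ∈ insert 0 unitSteps, ‖((dWaveFormFactor e / Real.sqrt 2 : ℝ) : ℂ)‖ ^ 2 :=
    Finset.sum_nonneg fun _ _ => by positivity
  rw [PairFieldCarrier.card_insert_zero_unitSteps, show ((5 : ℕ) : ℝ) = 5 by norm_num]
  nlinarith

/-- **The polarised ceiling with the constant evaluated**: `T_R(ψ) ≤ 100 · R² · (n - S) · ‖ψ‖²` for a
vector `ψ` of the `S^z = 0` sector `(n, n)` with `S² ψ = S(S+1) ψ`, `S ≤ n`, `0 < R`, `2R ≤ L`. [folklore] -/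
theorem boxSum_le_hundred_mul_spinDeficiency (R : ℕ) (hR : 0 < R) (hRL : 2 * R ≤ L) {n S : ℕ}
    (hS : S ≤ n) {ψ : Fock (Orb (FermionTorus 2 L))} (hψ : IsInSector n n ψ)
    (hspin : spinSq *ᵥ ψ = (((S : ℝ) * ((S : ℝ) + 1) : ℝ) : ℂ) • ψ) :
    (∑ x : TorusSite 2 L, ∑ y : TorusSite 2 L,
        (∏ i : Fin 2, max 0 (1 - |(((y i - x i).valMinAbs : ℤ) : ℝ)| / (R : ℝ))) *
          (star (localPair dWaveFormFactor L x *ᵥ ψ) ⬝ᵥ (localPair dWaveFormFactor L y *ᵥ ψ)).re) ≤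
      100 * (R : ℝ) ^ 2 * ((n - S : ℕ) : ℝ) * (star ψ ⬝ᵥ ψ).re := by
  have h := boxSum_le_sq_mul_spinDeficiency R hR hRL hS hψ hspin
  have hnn : 0 ≤ (R : ℝ) ^ 2 * ((n - S : ℕ) : ℝ) * (star ψ ⬝ᵥ ψ).re := by
    have : 0 ≤ (star ψ ⬝ᵥ ψ).re := EigenvalueContinuation.re_star_dotProduct_self_nonneg ψ
    positivity
  calc _ ≤ _ := h
    _ ≤ 100 * ((R : ℝ) ^ 2 * ((n - S : ℕ) : ℝ) * (star ψ ⬝ᵥ ψ).re) := by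
        rw [show 4 * (∑ e ∈ insert 0 unitSteps, ‖((dWaveFormFactor e / Real.sqrt 2 : ℝ) : ℂ)‖ ^ 2) *
            ((insert (0 : Site 2) unitSteps).card : ℝ) * (R : ℝ) ^ 2 * ((n - S : ℕ) : ℝ) *
              (star ψ ⬝ᵥ ψ).re =
            (4 * (∑ e ∈ insert 0 unitSteps, ‖((dWaveFormFactor e / Real.sqrt 2 : ℝ) : ℂ)‖ ^ 2) *
              ((insert (0 : Site 2) unitSteps).card : ℝ)) *
                ((R : ℝ) ^ 2 * ((n - S : ℕ) : ℝ) * (star ψ ⬝ᵥ ψ).re) by ring]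
        exact mul_le_mul_of_nonneg_right polarisedConstant_le_hundred hnn
    _ = _ := by ring

/-- **Registered form** (`boxSumLeHundredMulSpinDeficiency`, sub-goal of stmt-7331): the polarised ceiling
`T_R(ψ) ≤ 100 R² (n - S) ‖ψ‖²`, one-line verbatim signature. [folklore] -/
theorem boxSumLeHundredMulSpinDeficiency : ∀ {L : ℕ} [NeZero L] (R : ℕ), 0 < R → 2 * R ≤ L → ∀ {n S : ℕ}, S ≤ n → ∀ {ψ : Fock (Orb (FermionTorus 2 L))}, IsInSector n n ψ → spinSq *ᵥ ψ = (((S : ℝ) * ((S : ℝ) + 1) : ℝ) : ℂ) • ψ → (∑ x : TorusSite 2 L, ∑ y : TorusSite 2 L, (∏ i : Fin 2, max 0 (1 - |(((y i - x i).valMinAbs : ℤ) : ℝ)| / (R : ℝ))) * (star (localPair dWaveFormFactor L x *ᵥ ψ) ⬝ᵥ (localPair dWaveFormFactor L y *ᵥ ψ)).re) ≤ 100 * (R : ℝ) ^ 2 * ((n - S : ℕ) : ℝ) * (star ψ ⬝ᵥ ψ).re :=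
  fun R hR hRL _ _ hS _ hψ hspin => boxSum_le_hundred_mul_spinDeficiency R hR hRL hS hψ hspin

end Polarised

end Summit.HubbardSuperconductivity.HubbardSuperconductivity.Theorems.MesoscopicPairOrder.Negative
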